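import Literature.NumberTheory.GaloisCohomology.PoitouTateSelmerStructures
import Literature.NumberTheory.GaloisCohomology.PoitouTateIsPerfect
import HarnessLib

/-!
# Poitou–Tate for Selmer structures, COUNTING FORM: `#(H¹_𝓖/H¹_𝓕)(K, M) · #(H¹_{𝓕*}/H¹_{𝓖*})(K, M^D) · ∏_{v} #𝓕_v = ∏_{v} #𝓖_v`
# (Milne ADT I Thm. 4.10 / Howard 2004 Thm. 2.1.11 ⟹ the "product formula" behind every finite-level Selmer count)

`Proofs` file (theorems only: no definition, no named fact, debt `0`), topic `NumberTheory/GaloisCohomology`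
(namespace = path), continuing `PoitouTateSelmerStructures.lean`, whose module docstring lists under "Not here":
«the counting form `#Im(loc) · #Im(loc^*) = #⊕_{v∈S} 𝓖_v/𝓕_v` (needs the induced perfect pairing of the finite
quotients)».  This file proves it, from the three properties of a family of local invariant maps recorded there
(`IsPerfect`, `SumLocalTermEqZero`, `SelmerComplement`; the named fact `poitouTate_selmerStructure_duality K`
asserts one family with all of them).

PRINT.  Howard, Compositio 140 (2004) Thm. 2.1.11 / Mazur–Rubin, *Kolyvagin systems* Thm. 2.3.4 / Rubin, *Euler
Systems* Thm. 1.7.3: for Selmer structures `𝓕 ≤ 𝓖` on a finite `n`-torsion `M`, the images of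
`H¹_𝓖(K,M) → ⊕_v 𝓖_v/𝓕_v` and `H¹_{𝓕*}(K,M^*) → ⊕_v 𝓕*_v/𝓖*_v` are exact orthogonal complements under the sum of the
local Tate pairings; since the induced pairing `(𝓖_v/𝓕_v) × (𝓕*_v/𝓖*_v) → ℤ/n` is perfect, the two images have
complementary orders: `[H¹_𝓖(K,M) : H¹_𝓕(K,M)] · [H¹_{𝓕*}(K,M^*) : H¹_{𝓖*}(K,M^*)] = ∏_v [𝓖_v : 𝓕_v]`
(Darmon–Diamond–Taylor, *Fermat's Last Theorem*, Thm. 2.19's proof; Washington in Cornell–Silverman–Stevens, §5,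
Prop. 10; Wiles 1995 Prop. 1.6) — the input of every "Selmer group count" at finite level (Greenberg–Wiles
formula, Kato Prop. 14.16, Cassels–Poitou–Tate sequences).

## What is proved

* §1 (finite duality over `ℤ/n`, no Galois modules) `natCard_annihilator_mul_natCard` — for finite `A`, `B` killed
  by `n` and a bi-additive `b : A × B → ℤ/n` whose adjoint `A → Hom(B, ℤ/n)` is BIJECTIVE, the annihilator `U ≤ A`
  of a subgroup `X ≤ B` satisfies **`#U · #X = #B`** (`U ≅ Hom(B/X, ℤ/n)` and `#Hom(C, ℤ/n) = #C`, tree lemma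
  `Nat.card_addMonoidHom_zmod`); `natCard_eq_of_bijective` (`#A = #B`); `eq_of_le_annihilator_annihilator`
  (double annihilator `G = G^{⊥⊥}` for perfect `b`).
* §2 (the count) `natCard_selmerQuotient_mul_of_poitouTate` — for a family `inv` with `IsPerfect`,
  `SumLocalTermEqZero`, `SelmerComplement`; a finite `n`-torsion `M`; `S ⊇ {v ∣ ∞} ∪ {v ∣ n} ∪ Ram(M)`; Selmer
  structures `𝓕 ≤ 𝓖` unramified outside `S` that AGREE AT THE INFINITE PLACES (`𝓕_w = 𝓖_w`, automatic for odd
  `n`): with `S_f` the finite places in `S`,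
  **`#(H¹_𝓖(K,M)/H¹_𝓕(K,M)) · #(H¹_{𝓕*}(K,M^D)/H¹_{𝓖*}(K,M^D)) · ∏_{v∈S_f} #𝓕_v = ∏_{v∈S_f} #𝓖_v`.**
  Proof (Milne's): inside `A = ∏_{v∈S_f} H¹(K_v,M)`, `B = ∏_{v∈S_f} H¹(K_v,M^D)` with the (perfect) sum pairing,
  `L = loc(H¹_𝓖) + ∏𝓕_v` is the exact annihilator of `L' = loc(H¹_{𝓕*}) + ∏𝓖*_v` (⊆ by the Poitou–Tate vanishing,
  ⊇ by `SelmerComplement`), `∏𝓖_v` that of `∏𝓖*_v`; count with §1 and `H¹_𝓖/H¹_𝓕 ≅ L/∏𝓕_v`.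

HONEST FRAMING: kernel theorems over the tree's existing named fact; no new fact, no definition; nothing about any
summit is booked (cell `bsd-potss`, seat `rkm` g16: the level-0 Poitou–Tate COUNT is the named residual of crux
stmt-BirchSwinnertonDyer-19196 — this is its finite-coefficient case).

## References
* [MilneADT2006] J. S. Milne, *Arithmetic Duality Theorems*, 2nd ed., Ch. I Thm. 4.10 and its proof, Cor. 2.3, §0 Prop. 0.19.
* [Howard2004HeegnerKolyvagin] B. Howard, Compositio Math. 140 (2004), Thm. 2.1.11.
* [Rubin2000] K. Rubin, *Euler Systems*, Thm. 1.7.3.  * [WashingtonCSS1997] L. Washington, in Cornell–Silverman–Stevens, §5 Prop. 10.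
-/

noncomputable section

open Function NumberField IsDedekindDomain
open scoped NumberField

universe u

namespace Literature.NumberTheory.GaloisCohomology

open Literature.NumberTheory.GaloisRepresentations
open Literature.NumberTheory.GaloisRepresentations.DiscreteGaloisModule (mu localTatePairingZMod tateDual
  SelmerStructure)

-- (no local instance needed here: the local Tate pairings enter only through the bundled maps of `PoitouTate.lean`)

/-! ## §1 Finite duality over `ℤ/n`: annihilators have complementary order -/

section FiniteDuality

variable {A : Type*} [AddCommGroup A] {B : Type*} [AddCommGroup B] {n : ℕ} [NeZero n]

/-- **`#U · #X = #B` for the annihilator `U ≤ A` of `X ≤ B`** under a bi-additive `b : A × B → ℤ/n` whose adjoint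
`A → Hom(B, ℤ/n)` is bijective (`A`, `B` finite, `n·B = 0`): `U ≅ Hom(B/X, ℤ/n)` (a homomorphism killing `X` is a
homomorphism of `B/X`) and `#Hom(B/X, ℤ/n) = #(B/X)` (`Nat.card_addMonoidHom_zmod`), `#(B/X) · #X = #B`.
[cite: MilneADT2006, Ch. I §0 Prop. 0.19] -/
theorem natCard_annihilator_mul_natCard [Finite A] [Finite B] (hB : ∀ y : B, n • y = 0)
    (b : A →+ B →+ ZMod n) (hb : Bijective b) (X : AddSubgroup B) (U : AddSubgroup A)
    (hU : ∀ a : A, a ∈ U ↔ ∀ x ∈ X, b a x = 0) :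
    Nat.card U * Nat.card X = Nat.card B := by
  haveI : Finite (B ⧸ X) := Finite.of_surjective _ (QuotientAddGroup.mk'_surjective X)
  have hBX : ∀ y : B ⧸ X, n • y = 0 := fun y ↦ by
    obtain ⟨z, rfl⟩ := QuotientAddGroup.mk_surjective y
    rw [← QuotientAddGroup.mk_nsmul, hB z, QuotientAddGroup.mk_zero]
  -- `U → Hom(B/X, ℤ/n)`, `u ↦ (b u) mod X`
  have hker : ∀ u : U, X ≤ (b (u : A)).ker := fun u x hx ↦
    (AddMonoidHom.mem_ker).2 (((hU u).1 u.2) x hx)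
  let e : U → (B ⧸ X →+ ZMod n) := fun u ↦ QuotientAddGroup.lift X (b (u : A)) (hker u)
  have he : Bijective e := by
    constructor
    · intro u u' h
      apply Subtype.ext
      apply hb.1
      ext y
      have := DFunLike.congr_fun h (QuotientAddGroup.mk y)
      simpa [e] using this
    · intro g
      obtain ⟨a, ha⟩ := hb.2 (g.comp (QuotientAddGroup.mk' X))
      have haU : a ∈ U := (hU a).2 fun x hx ↦ by
        rw [ha, AddMonoidHom.comp_apply, QuotientAddGroup.mk'_apply, (QuotientAddGroup.eq_zero_iff x).2 hx,
          map_zero]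
      refine ⟨⟨a, haU⟩, ?_⟩
      ext y
      simp [e, ha]
  rw [Nat.card_congr (Equiv.ofBijective e he), Nat.card_addMonoidHom_zmod hBX,
    ← AddSubgroup.card_eq_card_quotient_mul_card_addSubgroup X]

/-- **`#A = #B`** for finite `A`, `B` killed by `n` under a bi-additive `b` with bijective adjoint `A → Hom(B, ℤ/n)`
(`A` is the annihilator of `0`). [cite: MilneADT2006, Ch. I §0 Prop. 0.19] -/
theorem natCard_eq_of_bijective [Finite A] [Finite B] (hB : ∀ y : B, n • y = 0)
    (b : A →+ B →+ ZMod n) (hb : Bijective b) : Nat.card A = Nat.card B := by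
  have h := natCard_annihilator_mul_natCard hB b hb ⊥ ⊤ fun a ↦
    ⟨fun _ x hx ↦ by rw [(AddSubgroup.mem_bot).1 hx, map_zero], fun _ ↦ AddSubgroup.mem_top a⟩
  rwa [AddSubgroup.card_bot, mul_one, AddSubgroup.card_top] at h

/-- **Double annihilator: `G = G^{⊥⊥}`** for a PERFECT `b` (both adjoints bijective; `A`, `B` finite, killed by `n`):
if `Gd ≤ B` is the annihilator of `G ≤ A` and `Gdd ≤ A` that of `Gd`, then `Gdd = G` (`G ≤ Gdd` and both have order
`#A/#Gd`). [cite: MilneADT2006, Ch. I §0 Prop. 0.19] -/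
theorem eq_of_annihilator_annihilator [Finite A] [Finite B] (hA : ∀ x : A, n • x = 0)
    (hB : ∀ y : B, n • y = 0) (b : A →+ B →+ ZMod n) (hb : Bijective b) (hb' : Bijective b.flip)
    (G Gdd : AddSubgroup A) (Gd : AddSubgroup B) (hGd : ∀ y : B, y ∈ Gd ↔ ∀ x ∈ G, b x y = 0)
    (hGdd : ∀ x : A, x ∈ Gdd ↔ ∀ y ∈ Gd, b x y = 0) : Gdd = G := by
  have h1 : Nat.card Gdd * Nat.card Gd = Nat.card B := natCard_annihilator_mul_natCard hB b hb Gd Gdd hGdd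
  have h2 : Nat.card Gd * Nat.card G = Nat.card A :=
    natCard_annihilator_mul_natCard hA b.flip hb' G Gd fun y ↦ by
      simpa only [AddMonoidHom.flip_apply] using hGd y
  have hAB : Nat.card A = Nat.card B := natCard_eq_of_bijective hB b hb
  have hle : G ≤ Gdd := fun x hx ↦ (hGdd x).2 fun y hy ↦ (hGd y).1 hy x hx
  have hGd0 : Nat.card Gd ≠ 0 := Nat.card_pos.ne'
  have hcard : Nat.card G = Nat.card Gdd := by
    apply Nat.eq_of_mul_eq_mul_left (Nat.pos_of_ne_zero hGd0)
    rw [h2, mul_comm, h1, hAB]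
  exact (AddSubgroup.eq_of_le_of_card_ge hle hcard.ge).symm

/-- **Pointwise double annihilator**: for a perfect `b` and `Gd` the annihilator of `G`, every `a ∈ A` annihilating `Gd`
lies in `G`. [cite: MilneADT2006, Ch. I §0 Prop. 0.19] -/
theorem mem_of_forall_annihilator_eq_zero [Finite A] [Finite B] (hA : ∀ x : A, n • x = 0)
    (hB : ∀ y : B, n • y = 0) (b : A →+ B →+ ZMod n) (hb : Bijective b) (hb' : Bijective b.flip)
    (G : AddSubgroup A) (Gd : AddSubgroup B) (hGd : ∀ y : B, y ∈ Gd ↔ ∀ x ∈ G, b x y = 0)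
    (a : A) (ha : ∀ y ∈ Gd, b a y = 0) : a ∈ G := by
  let Gdd : AddSubgroup A := ⨅ y ∈ Gd, (b.flip y).ker
  have hGdd : ∀ x : A, x ∈ Gdd ↔ ∀ y ∈ Gd, b x y = 0 := fun x ↦ by
    simp only [Gdd, AddSubgroup.mem_iInf, AddMonoidHom.mem_ker, AddMonoidHom.flip_apply]
  rw [← eq_of_annihilator_annihilator hA hB b hb hb' G Gdd Gd hGd hGdd]
  exact (hGdd a).2 ha

end FiniteDuality

/-! ## §2 Sums of pairings on finite products; product subgroups -/

section Products

variable {ι : Type*} [Fintype ι] [DecidableEq ι] {A B : ι → Type*} [∀ i, AddCommGroup (A i)]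
  [∀ i, AddCommGroup (B i)] {Z : Type*} [AddCommGroup Z]

/-- A sum of pairings `bS(t, u) = ∑_i b_i(t_i, u_i)` on finite products evaluates on a vector supported at one index.
[folklore] -/
private theorem sum_pairing_apply_single (P : ∀ i, A i →+ B i →+ Z) (bS : (∀ i, A i) →+ (∀ i, B i) →+ Z)
    (hbS : ∀ t u, bS t u = ∑ i, P i (t i) (u i)) (t : ∀ i, A i) (i : ι) (y : B i) :
    bS t (Pi.single i y) = P i (t i) y := by
  rw [hbS, Finset.sum_eq_single i]
  · rw [Pi.single_eq_same]
  · intro j _ hj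
    rw [Pi.single_eq_of_ne hj, map_zero]
  · intro h
    exact absurd (Finset.mem_univ i) h

/-- Dually, on a vector supported at one index in the first variable. [folklore] -/
private theorem sum_pairing_single_apply (P : ∀ i, A i →+ B i →+ Z) (bS : (∀ i, A i) →+ (∀ i, B i) →+ Z)
    (hbS : ∀ t u, bS t u = ∑ i, P i (t i) (u i)) (i : ι) (x : A i) (u : ∀ i, B i) :
    bS (Pi.single i x) u = P i x (u i) := by
  rw [hbS, Finset.sum_eq_single i]
  · rw [Pi.single_eq_same]
  · intro j _ hj
    rw [Pi.single_eq_of_ne hj, map_zero, AddMonoidHom.zero_apply]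
  · intro h
    exact absurd (Finset.mem_univ i) h

/-- **A sum of pairings with injective adjoints has injective adjoint** (test against vectors supported at one
index). [folklore] -/
private theorem injective_sum_pairing (P : ∀ i, A i →+ B i →+ Z) (hP : ∀ i, Injective (P i))
    (bS : (∀ i, A i) →+ (∀ i, B i) →+ Z) (hbS : ∀ t u, bS t u = ∑ i, P i (t i) (u i)) :
    Injective bS := by
  intro t t' h
  funext i
  apply hP i
  ext y
  have := DFunLike.congr_fun h (Pi.single i y)
  rwa [sum_pairing_apply_single P bS hbS, sum_pairing_apply_single P bS hbS] at this

/-- The flipped statement: injective right adjoints give an injective right adjoint of the sum. [folklore] -/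
private theorem injective_flip_sum_pairing (P : ∀ i, A i →+ B i →+ Z) (hP : ∀ i, Injective (P i).flip)
    (bS : (∀ i, A i) →+ (∀ i, B i) →+ Z) (hbS : ∀ t u, bS t u = ∑ i, P i (t i) (u i)) :
    Injective bS.flip := by
  intro u u' h
  funext i
  apply hP i
  ext x
  have := DFunLike.congr_fun h (Pi.single i x)
  rw [AddMonoidHom.flip_apply, AddMonoidHom.flip_apply, sum_pairing_single_apply P bS hbS,
    sum_pairing_single_apply P bS hbS] at this
  rwa [AddMonoidHom.flip_apply, AddMonoidHom.flip_apply]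

/-- **Product subgroups are annihilators of product subgroups**: if at every index `Gd_i` is the annihilator of `G_i`
and every `a` annihilating `Gd_i` lies in `G_i` (local double annihilator), then `t ∈ ∏ G_i` iff `bS(t, u) = 0` for all
`u ∈ ∏ Gd_i`. [folklore] -/
private theorem mem_pi_iff_forall_sum_pairing_eq_zero (P : ∀ i, A i →+ B i →+ Z)
    (bS : (∀ i, A i) →+ (∀ i, B i) →+ Z) (hbS : ∀ t u, bS t u = ∑ i, P i (t i) (u i))
    (G : ∀ i, AddSubgroup (A i)) (Gd : ∀ i, AddSubgroup (B i))
    (hGd : ∀ i (y : B i), y ∈ Gd i ↔ ∀ x ∈ G i, P i x y = 0)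
    (hGdd : ∀ i (x : A i), (∀ y ∈ Gd i, P i x y = 0) → x ∈ G i) (t : ∀ i, A i) :
    t ∈ AddSubgroup.pi Set.univ G ↔ ∀ u ∈ AddSubgroup.pi Set.univ Gd, bS t u = 0 := by
  constructor
  · intro ht u hu
    rw [hbS]
    exact Finset.sum_eq_zero fun i _ ↦ (hGd i (u i)).1 ((AddSubgroup.mem_pi _).1 hu i trivial) (t i)
      ((AddSubgroup.mem_pi _).1 ht i trivial)
  · intro h
    refine (AddSubgroup.mem_pi _).2 fun i _ ↦ hGdd i (t i) fun y hy ↦ ?_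
    have hu : (Pi.single i y : ∀ j, B j) ∈ AddSubgroup.pi Set.univ Gd := by
      refine (AddSubgroup.mem_pi _).2 fun j _ ↦ ?_
      by_cases hj : j = i
      · subst hj; rw [Pi.single_eq_same]; exact hy
      · rw [Pi.single_eq_of_ne hj]; exact (Gd j).zero_mem
    have := h _ hu
    rwa [sum_pairing_apply_single P bS hbS] at this

omit [DecidableEq ι] [∀ i, AddCommGroup (B i)] in
/-- `#(∏_i G_i) = ∏_i #G_i` for a product subgroup over a finite index type. [folklore] -/
private theorem natCard_pi_univ (G : ∀ i, AddSubgroup (A i)) :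
    Nat.card (AddSubgroup.pi Set.univ G) = ∏ i, Nat.card (G i) := by
  let e : AddSubgroup.pi Set.univ G ≃ ∀ i, G i :=
    { toFun := fun x i ↦ ⟨x.1 i, (AddSubgroup.mem_pi _).1 x.2 i trivial⟩
      invFun := fun y ↦ ⟨fun i ↦ (y i : A i), (AddSubgroup.mem_pi _).2 fun i _ ↦ (y i).2⟩
      left_inv := fun x ↦ rfl
      right_inv := fun y ↦ rfl }
  rw [Nat.card_congr e, Nat.card_pi]

end Products

/-! ## §3 Index bookkeeping in an ambient group -/

section Index

variable {A : Type*} [AddCommGroup A]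

/-- For subgroups `N ≤ L` of an abelian group, **`#L = #(L mod N) · #N`**, `L mod N = L.map (A → A/N)`. [folklore] -/
private theorem natCard_eq_natCard_map_mk_mul {N L : AddSubgroup A} (h : N ≤ L) :
    Nat.card L = Nat.card (L.map (QuotientAddGroup.mk' N)) * Nat.card N := by
  let f : L →+ A ⧸ N := (QuotientAddGroup.mk' N).comp L.subtype
  have hker : f.ker = N.addSubgroupOf L := by
    ext x
    rw [AddMonoidHom.mem_ker, AddSubgroup.mem_addSubgroupOf]
    change QuotientAddGroup.mk' N (x : A) = 0 ↔ _
    rw [QuotientAddGroup.mk'_apply, QuotientAddGroup.eq_zero_iff]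
  have hrange : f.range = L.map (QuotientAddGroup.mk' N) := by
    rw [AddMonoidHom.range_comp, AddSubgroup.range_subtype]
  rw [← AddSubgroup.card_mul_index f.ker, AddSubgroup.index_ker f, hrange, hker,
    Nat.card_congr (AddSubgroup.addSubgroupOfEquivOfLe h).toEquiv, mul_comm]

/-- For an additive map `g : C →+ A` and `N ≤ A`: **`#(C ⧸ g⁻¹N) = #((g(C) + N) mod N)`** — the quotient of `C` by the
preimage of `N` is the image of `g(C) ⊔ N` in `A/N`. [folklore] -/
private theorem natCard_quotient_comap_eq {C : Type*} [AddCommGroup C] (g : C →+ A) (N : AddSubgroup A) :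
    Nat.card (C ⧸ N.comap g) = Nat.card ((g.range ⊔ N).map (QuotientAddGroup.mk' N)) := by
  let f : C →+ A ⧸ N := (QuotientAddGroup.mk' N).comp g
  have hker : f.ker = N.comap g := by
    ext x
    rw [AddMonoidHom.mem_ker, AddSubgroup.mem_comap]
    change QuotientAddGroup.mk' N (g x) = 0 ↔ _
    rw [QuotientAddGroup.mk'_apply, QuotientAddGroup.eq_zero_iff]
  have hrange : f.range = (g.range ⊔ N).map (QuotientAddGroup.mk' N) := by
    rw [AddSubgroup.map_sup, QuotientAddGroup.map_mk'_self, sup_bot_eq, AddMonoidHom.range_comp]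
  rw [← hker, ← hrange]
  exact Nat.card_congr (QuotientAddGroup.quotientKerEquivRange f).toEquiv

end Index

/-! ## §4 The counting form of Poitou–Tate duality for Selmer structures -/

section Count

variable {K : Type u} [Field K] [NumberField K] {n : ℕ} [NeZero n]
  {M : Type u} [AddCommGroup M] [TopologicalSpace M] [DiscreteTopology M] [Finite M]

omit [NeZero n] in
/-- The Poitou–Tate VANISHING read on the finite places `S_f`: for `x ∈ H¹_𝓖(K,M)`, `y ∈ H¹_{𝓕*}(K,M^D)` with `𝓖 ≤ 𝓕`
off `S_f` (as places of `K`), `∑_{v ∈ S_f} ⟨loc_v x, loc_v y⟩_v = 0`. [cite: MilneADT2006, Ch. I, Thm. 4.10] -/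
theorem sum_localTatePairingZMod_loc_eq_zero {inv : LocalInvariants K n} (hvan : inv.SumLocalTermEqZero)
    (ρ : DiscreteGaloisModule K M) (hM : ∀ m : M, n • m = 0) {𝓕 𝓖 : SelmerStructure ρ}
    (Sf : Finset (HeightOneSpectrum (𝓞 K)))
    (hout : ∀ v : Place K, (∀ v' ∈ Sf, v ≠ Sum.inr v') → 𝓖 v ≤ 𝓕 v)
    {x : galoisCohomology ρ 1} (hx : x ∈ 𝓖.selmerGroup)
    {y : galoisCohomology (ρ.tateDual n) 1} (hy : y ∈ (inv.dualSelmerStructure ρ 𝓕).selmerGroup) :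
    ∑ v ∈ Sf, localTatePairingZMod ρ n (Sum.inr v) (inv (Sum.inr v))
      (galoisCohomology.localization ρ (Sum.inr v) 1 x)
      (galoisCohomology.localization (ρ.tateDual n) (Sum.inr v) 1 y) = 0 := by
  have hout' : ∀ v ∉ Sf.map ⟨Sum.inr, Sum.inr_injective⟩, 𝓖 v ≤ 𝓕 v := fun v hv ↦
    hout v fun v' hv' hvv' ↦ hv (Finset.mem_map.2 ⟨v', hv', hvv'.symm⟩)
  have h := hvan.sum_localTerm_selmer_eq_zero ρ hM hout' hx hy
  rw [Finset.sum_map] at h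
  refine (Finset.sum_congr rfl fun v _ ↦ ?_).trans h
  simp only [LocalInvariants.localTerm_apply, DiscreteGaloisModule.localTatePairingZMod_apply,
    Function.Embedding.coeFn_mk]

/-- **Poitou–Tate duality for Selmer structures, counting form** (Milne ADT I Thm. 4.10 ⟹ Howard Thm. 2.1.11 ⟹ the
product formula).  Let `inv` be a family of local invariant maps with local Tate duality (`IsPerfect`), the
Poitou–Tate vanishing (`SumLocalTermEqZero`) and the complement property (`SelmerComplement`) — the named fact
`poitouTate_selmerStructure_duality K` provides one.  Let `M` be a finite discrete `Γ_K`-module killed by `n`, `S` a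
finite set of places containing the archimedean places, the places above `n` and the ramified places of `M`, and
`𝓕 ≤ 𝓖` Selmer structures on `M` unramified outside `S` which agree at the infinite places.  Then, with `S_f` the
finite places of `S`,
**`#(H¹_𝓖(K,M)/H¹_𝓕(K,M)) · #(H¹_{𝓕*}(K,M^D)/H¹_{𝓖*}(K,M^D)) · ∏_{v ∈ S_f} #𝓕_v = ∏_{v ∈ S_f} #𝓖_v`**
(quotients as `H¹_𝓖 ⧸ H¹_𝓕` etc.; all groups are finite).  [cite: MilneADT2006, Ch. I, Thm. 4.10]
[cite: Howard2004HeegnerKolyvagin, Thm. 2.1.11 (arXiv:1202.6340 p. 6)] [cite: Rubin2000, Thm. 1.7.3] -/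
theorem natCard_selmerQuotient_mul_of_poitouTate {inv : LocalInvariants K n} (hperf : inv.IsPerfect)
    (hvan : inv.SumLocalTermEqZero) (hcomp : inv.SelmerComplement)
    (ρ : DiscreteGaloisModule K M) (hM : ∀ m : M, n • m = 0) (S : Finset (Place K))
    (hS : ∀ v : HeightOneSpectrum (𝓞 K), (Sum.inr v : Place K) ∉ S →
      ((n : ℕ) : 𝓞 K) ∉ v.asIdeal ∧ GaloisRep.IsUnramifiedAt v ρ)
    {𝓕 𝓖 : SelmerStructure ρ} (hle : 𝓕 ≤ 𝓖) (h𝓕 : 𝓕.IsUnramifiedOutside S) (h𝓖 : 𝓖.IsUnramifiedOutside S)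
    (hinf : ∀ w : InfinitePlace K, 𝓕 (Sum.inl w) = 𝓖 (Sum.inl w))
    (Sf : Finset (HeightOneSpectrum (𝓞 K))) (hSf : ∀ v, v ∈ Sf ↔ (Sum.inr v : Place K) ∈ S) :
    Nat.card (𝓖.selmerGroup ⧸ (𝓕.selmerGroup).addSubgroupOf 𝓖.selmerGroup) *
      Nat.card ((inv.dualSelmerStructure ρ 𝓕).selmerGroup ⧸
        ((inv.dualSelmerStructure ρ 𝓖).selmerGroup).addSubgroupOf (inv.dualSelmerStructure ρ 𝓕).selmerGroup) *
      ∏ v ∈ Sf, Nat.card (𝓕 (Sum.inr v)) = ∏ v ∈ Sf, Nat.card (𝓖 (Sum.inr v)) := by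
  classical
  -- `𝓕 = 𝓖` off `S_f`
  have heq : ∀ v : Place K, (∀ v' ∈ Sf, v ≠ Sum.inr v') → 𝓕 v = 𝓖 v := by
    intro v hv
    cases v with
    | inl w => exact hinf w
    | inr v' =>
      have hv' : (Sum.inr v' : Place K) ∉ S := fun h ↦ hv v' ((hSf v').2 h) rfl
      exact h𝓕.apply_eq_of_not_mem h𝓖 hv'
  -- abbreviations for the local groups at `S_f` (types only)
  let Av : Sf → Type u := fun v ↦ galoisCohomology (ρ.toLocal (Sum.inr (v : HeightOneSpectrum (𝓞 K)))) 1
  let Bv : Sf → Type u := fun v ↦ galoisCohomology ((ρ.tateDual n).toLocal (Sum.inr (v : HeightOneSpectrum (𝓞 K)))) 1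
  haveI hfinA : ∀ v : Sf, Finite (Av v) := fun v ↦ finite_galoisCohomology_one_toLocal ρ v
  haveI hfinB : ∀ v : Sf, Finite (Bv v) := fun v ↦ finite_galoisCohomology_one_tateDual_toLocal ρ n v
  -- local pairings
  let P : ∀ v : Sf, Av v →+ Bv v →+ ZMod n :=
    fun v ↦ localTatePairingZMod ρ n (Sum.inr (v : HeightOneSpectrum (𝓞 K))) (inv (Sum.inr v))
  have hPdef : ∀ (v : Sf) a b, P v a b =
      localTatePairingZMod ρ n (Sum.inr (v : HeightOneSpectrum (𝓞 K))) (inv (Sum.inr v)) a b := fun _ _ _ ↦ rfl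
  have hPbij : ∀ v : Sf, Bijective (P v) ∧ Bijective (P v).flip := fun v ↦ (hperf v).2 ρ hM
  have hAn : ∀ t : (∀ v, Av v), n • t = 0 := fun t ↦ funext fun v ↦ by
    rw [Pi.smul_apply, Pi.zero_apply]; exact galoisCohomology.nsmul_eq_zero_of_forall _ hM _
  have hBn : ∀ u : (∀ v, Bv v), n • u = 0 := fun u ↦ funext fun v ↦ by
    rw [Pi.smul_apply, Pi.zero_apply]
    exact galoisCohomology.nsmul_eq_zero_of_forall _ (fun f ↦ DiscreteGaloisModule.TateDual.nsmul_eq_zero f) _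
  -- the sum pairing and its perfectness
  let bS : (∀ v, Av v) →+ (∀ v, Bv v) →+ ZMod n :=
    ∑ v : Sf, ((P v).comp (Pi.evalAddMonoidHom Av v)).compl₂ (Pi.evalAddMonoidHom Bv v)
  have hbS : ∀ t u, bS t u = ∑ v, P v (t v) (u v) := fun t u ↦ by
    simp only [bS, AddMonoidHom.finsetSum_apply, AddMonoidHom.compl₂_apply, AddMonoidHom.comp_apply,
      Pi.evalAddMonoidHom_apply]
  have hbSbij : Bijective bS ∧ Bijective bS.flip :=
    AddMonoidHom.bijective_of_injective_of_injective_flip hAn hBn bS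
      (injective_sum_pairing P (fun v ↦ (hPbij v).1.1) bS hbS)
      (injective_flip_sum_pairing P (fun v ↦ (hPbij v).2.1) bS hbS)
  -- product subgroups
  let GS : AddSubgroup (∀ v, Av v) :=
    AddSubgroup.pi Set.univ (fun v : Sf ↦ 𝓖 (Sum.inr (v : HeightOneSpectrum (𝓞 K))))
  let FS : AddSubgroup (∀ v, Av v) :=
    AddSubgroup.pi Set.univ (fun v : Sf ↦ 𝓕 (Sum.inr (v : HeightOneSpectrum (𝓞 K))))
  let GdS : AddSubgroup (∀ v, Bv v) := AddSubgroup.pi Set.univ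
    (fun v : Sf ↦ inv.dualLocalCondition ρ (Sum.inr (v : HeightOneSpectrum (𝓞 K))) (𝓖 (Sum.inr v)))
  -- (a) `∏ 𝓖_v` is the annihilator of `∏ 𝓖*_v`
  have hGann : ∀ t, t ∈ GS ↔ ∀ u ∈ GdS, bS t u = 0 :=
    mem_pi_iff_forall_sum_pairing_eq_zero P bS hbS _ _
      (fun v y ↦ LocalInvariants.mem_dualLocalCondition_iff inv ρ _ _ y)
      (fun v x hx ↦ mem_of_forall_annihilator_eq_zero (galoisCohomology.nsmul_eq_zero_of_forall _ hM)
          (galoisCohomology.nsmul_eq_zero_of_forall _ (fun f ↦ DiscreteGaloisModule.TateDual.nsmul_eq_zero f))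
          (P v) (hPbij v).1 (hPbij v).2 (𝓖 (Sum.inr (v : HeightOneSpectrum (𝓞 K)))) _
          (fun y ↦ LocalInvariants.mem_dualLocalCondition_iff inv ρ _ _ y) x hx)
  have cardG : Nat.card GS * Nat.card GdS = Nat.card (∀ v, Bv v) :=
    natCard_annihilator_mul_natCard hBn bS hbSbij.1 GdS GS hGann
  -- (b) the global images
  let locS : galoisCohomology ρ 1 →+ (∀ v, Av v) :=
    AddMonoidHom.pi fun v ↦ galoisCohomology.localization ρ (Sum.inr (v : HeightOneSpectrum (𝓞 K))) 1
  let locS' : galoisCohomology (ρ.tateDual n) 1 →+ (∀ v, Bv v) :=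
    AddMonoidHom.pi fun v ↦ galoisCohomology.localization (ρ.tateDual n) (Sum.inr (v : HeightOneSpectrum (𝓞 K))) 1
  have hlocS : ∀ x (v : Sf), locS x v = galoisCohomology.localization ρ (Sum.inr (v : HeightOneSpectrum (𝓞 K))) 1 x :=
    fun _ _ ↦ rfl
  have hlocS' : ∀ y (v : Sf), locS' y v =
      galoisCohomology.localization (ρ.tateDual n) (Sum.inr (v : HeightOneSpectrum (𝓞 K))) 1 y := fun _ _ ↦ rfl
  let L : AddSubgroup (∀ v, Av v) := (𝓖.selmerGroup).map locS ⊔ FS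
  let L' : AddSubgroup (∀ v, Bv v) := ((inv.dualSelmerStructure ρ 𝓕).selmerGroup).map locS' ⊔ GdS
  -- the Poitou–Tate vanishing on `S_f`
  have hvanS : ∀ x ∈ 𝓖.selmerGroup, ∀ y ∈ (inv.dualSelmerStructure ρ 𝓕).selmerGroup,
      bS (locS x) (locS' y) = 0 := by
    intro x hx y hy
    rw [hbS]
    simp only [hPdef, hlocS, hlocS']
    rw [Finset.sum_coe_sort Sf (fun v ↦ localTatePairingZMod ρ n (Sum.inr v) (inv (Sum.inr v))
      (galoisCohomology.localization ρ (Sum.inr v) 1 x)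
      (galoisCohomology.localization (ρ.tateDual n) (Sum.inr v) 1 y))]
    exact sum_localTatePairingZMod_loc_eq_zero hvan ρ hM Sf (fun v hv ↦ (heq v hv).ge) hx hy
  -- `L` is the annihilator of `L'`
  have hLann : ∀ t, t ∈ L ↔ ∀ u ∈ L', bS t u = 0 := by
    intro t
    constructor
    · intro ht u hu
      obtain ⟨a, ha, f, hf, rfl⟩ := AddSubgroup.mem_sup.1 ht
      obtain ⟨x, hx, rfl⟩ := AddSubgroup.mem_map.1 ha
      obtain ⟨c, hc, g, hg, rfl⟩ := AddSubgroup.mem_sup.1 hu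
      obtain ⟨y, hy, rfl⟩ := AddSubgroup.mem_map.1 hc
      have hx' := (SelmerStructure.mem_selmerGroup_iff 𝓖 x).1 hx
      have hy' := (SelmerStructure.mem_selmerGroup_iff _ y).1 hy
      -- the three remaining terms vanish place by place
      have h2 : bS (locS x) g = 0 := by
        rw [hbS]; refine Finset.sum_eq_zero fun v _ ↦ ?_
        exact (LocalInvariants.mem_dualLocalCondition_iff inv ρ _ _ (g v)).1
          ((AddSubgroup.mem_pi _).1 hg v trivial) _ (hx' _)
      have h3 : bS f (locS' y) = 0 := by
        rw [hbS]; refine Finset.sum_eq_zero fun v _ ↦ ?_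
        have hyv := hy' (Sum.inr (v : HeightOneSpectrum (𝓞 K)))
        rw [LocalInvariants.dualSelmerStructure_apply, LocalInvariants.mem_dualLocalCondition_iff] at hyv
        exact hyv _ ((AddSubgroup.mem_pi _).1 hf v trivial)
      have h4 : bS f g = 0 := by
        rw [hbS]; refine Finset.sum_eq_zero fun v _ ↦ ?_
        exact (LocalInvariants.mem_dualLocalCondition_iff inv ρ _ _ (g v)).1
          ((AddSubgroup.mem_pi _).1 hg v trivial) _ (hle _ ((AddSubgroup.mem_pi _).1 hf v trivial))
      simp only [map_add, AddMonoidHom.add_apply, hvanS x hx y hy, h2, h3, h4, add_zero]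
    · intro h
      -- `t ∈ ∏ 𝓖_v`
      have htG : t ∈ GS := (hGann t).2 fun u hu ↦ h u (AddSubgroup.mem_sup_right hu)
      -- extend `t` by zero to all places and apply the complement property
      let T : ∀ v : Place K, galoisCohomology (ρ.toLocal v) 1 := fun v ↦
        match v with
        | Sum.inl _ => 0
        | Sum.inr v' => if hv' : v' ∈ Sf then t ⟨v', hv'⟩ else 0
      have hTinr : ∀ v : Sf, T (Sum.inr (v : HeightOneSpectrum (𝓞 K))) = t v := fun v ↦ by
        simp only [T, dif_pos v.2]
      have hTG : ∀ v ∈ S, T v ∈ 𝓖 v := by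
        intro v hv
        cases v with
        | inl w => exact (𝓖 _).zero_mem
        | inr v' =>
          have hv' : v' ∈ Sf := (hSf v').2 hv
          rw [show T (Sum.inr v') = t ⟨v', hv'⟩ from hTinr ⟨v', hv'⟩]
          exact (AddSubgroup.mem_pi _).1 htG ⟨v', hv'⟩ trivial
      have hsub : Sf.map ⟨Sum.inr, Sum.inr_injective⟩ ⊆ S := fun v hv ↦ by
        obtain ⟨v', hv', rfl⟩ := Finset.mem_map.1 hv
        exact (hSf v').1 hv'
      have horth : ∀ y ∈ (inv.dualSelmerStructure ρ 𝓕).selmerGroup,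
          ∑ v ∈ S, localTatePairingZMod ρ n v (inv v) (T v)
            (galoisCohomology.localization (ρ.tateDual n) v 1 y) = 0 := by
        intro y hy
        have h0 := h (locS' y) (AddSubgroup.mem_sup_left (AddSubgroup.mem_map_of_mem _ hy))
        rw [hbS] at h0
        have hzero : ∀ v ∈ S, v ∉ Sf.map ⟨Sum.inr, Sum.inr_injective⟩ →
            localTatePairingZMod ρ n v (inv v) (T v) (galoisCohomology.localization (ρ.tateDual n) v 1 y) = 0 := by
          intro v hvS hv
          cases v with
          | inl w =>
            change localTatePairingZMod ρ n (Sum.inl w) (inv (Sum.inl w)) 0 _ = 0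
            rw [map_zero, AddMonoidHom.zero_apply]
          | inr v' => exact absurd (Finset.mem_map.2 ⟨v', (hSf v').2 hvS, rfl⟩) hv
        rw [← Finset.sum_subset hsub hzero, Finset.sum_map, ← Finset.sum_coe_sort]
        refine (Finset.sum_congr rfl fun v _ ↦ ?_).trans h0
        rw [hPdef, hlocS', ← hTinr v]
        rfl
      obtain ⟨x, hx, hxT⟩ := (hcomp ρ hM S hS 𝓕 𝓖 hle h𝓕 h𝓖).1 T hTG horth
      -- `t = loc(x) + (t - loc x)` with `t - loc x ∈ ∏ 𝓕_v`
      refine AddSubgroup.mem_sup.2 ⟨locS x, AddSubgroup.mem_map_of_mem _ hx, t - locS x, ?_, add_sub_cancel _ _⟩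
      refine (AddSubgroup.mem_pi _).2 fun v _ ↦ ?_
      have h1 := hxT (Sum.inr (v : HeightOneSpectrum (𝓞 K))) ((hSf v).1 v.2)
      rw [hTinr v] at h1
      rw [Pi.sub_apply, hlocS, ← neg_sub]
      exact (𝓕 _).neg_mem h1
  have cardL : Nat.card L * Nat.card L' = Nat.card (∀ v, Bv v) :=
    natCard_annihilator_mul_natCard hBn bS hbSbij.1 L' L hLann
  -- (c) the quotients: `H¹_𝓖/H¹_𝓕 ≅ L/FS`, `H¹_{𝓕*}/H¹_{𝓖*} ≅ L'/GdS`
  have hker : (𝓕.selmerGroup).addSubgroupOf 𝓖.selmerGroup = FS.comap (locS.comp (𝓖.selmerGroup).subtype) := by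
    ext x
    rw [AddSubgroup.mem_addSubgroupOf, AddSubgroup.mem_comap, AddSubgroup.mem_pi,
      SelmerStructure.mem_selmerGroup_iff]
    constructor
    · intro hx v _
      exact hx _
    · intro hx v
      by_cases hv : ∃ v' ∈ Sf, v = Sum.inr v'
      · obtain ⟨v', hv', rfl⟩ := hv
        exact hx ⟨v', hv'⟩ trivial
      · rw [heq v fun v' hv'S hvv' ↦ hv ⟨v', hv'S, hvv'⟩]
        exact (SelmerStructure.mem_selmerGroup_iff 𝓖 _).1 x.2 v
  have hker' : ((inv.dualSelmerStructure ρ 𝓖).selmerGroup).addSubgroupOf (inv.dualSelmerStructure ρ 𝓕).selmerGroup =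
      GdS.comap (locS'.comp ((inv.dualSelmerStructure ρ 𝓕).selmerGroup).subtype) := by
    ext y
    rw [AddSubgroup.mem_addSubgroupOf, AddSubgroup.mem_comap, AddSubgroup.mem_pi,
      SelmerStructure.mem_selmerGroup_iff]
    constructor
    · intro hy v _
      have h1 := hy (Sum.inr (v : HeightOneSpectrum (𝓞 K)))
      rwa [LocalInvariants.dualSelmerStructure_apply] at h1
    · intro hy v
      by_cases hv : ∃ v' ∈ Sf, v = Sum.inr v'
      · obtain ⟨v', hv', rfl⟩ := hv
        rw [LocalInvariants.dualSelmerStructure_apply]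
        exact hy ⟨v', hv'⟩ trivial
      · have h1 := (SelmerStructure.mem_selmerGroup_iff _ _).1 y.2 v
        rw [LocalInvariants.dualSelmerStructure_apply] at h1 ⊢
        rwa [← heq v fun v' hv'S hvv' ↦ hv ⟨v', hv'S, hvv'⟩]
  have hrange : (locS.comp (𝓖.selmerGroup).subtype).range = (𝓖.selmerGroup).map locS := by
    rw [AddMonoidHom.range_comp, AddSubgroup.range_subtype]
  have hrange' : (locS'.comp ((inv.dualSelmerStructure ρ 𝓕).selmerGroup).subtype).range =
      ((inv.dualSelmerStructure ρ 𝓕).selmerGroup).map locS' := by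
    rw [AddMonoidHom.range_comp, AddSubgroup.range_subtype]
  have q1 : Nat.card (𝓖.selmerGroup ⧸ (𝓕.selmerGroup).addSubgroupOf 𝓖.selmerGroup) * Nat.card FS = Nat.card L := by
    have e1 := natCard_quotient_comap_eq (locS.comp (𝓖.selmerGroup).subtype) FS
    have e2 := natCard_eq_natCard_map_mk_mul (le_sup_right : FS ≤ L)
    rw [hrange] at e1
    rw [hker, e1, e2]
  have q2 : Nat.card ((inv.dualSelmerStructure ρ 𝓕).selmerGroup ⧸
      ((inv.dualSelmerStructure ρ 𝓖).selmerGroup).addSubgroupOf (inv.dualSelmerStructure ρ 𝓕).selmerGroup) *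
      Nat.card GdS = Nat.card L' := by
    have e1 := natCard_quotient_comap_eq (locS'.comp ((inv.dualSelmerStructure ρ 𝓕).selmerGroup).subtype) GdS
    have e2 := natCard_eq_natCard_map_mk_mul (le_sup_right : GdS ≤ L')
    rw [hrange'] at e1
    rw [hker', e1, e2]
  -- (d) assemble
  have hGdS0 : Nat.card GdS ≠ 0 := Nat.card_pos.ne'
  have key : Nat.card (𝓖.selmerGroup ⧸ (𝓕.selmerGroup).addSubgroupOf 𝓖.selmerGroup) *
      Nat.card ((inv.dualSelmerStructure ρ 𝓕).selmerGroup ⧸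
        ((inv.dualSelmerStructure ρ 𝓖).selmerGroup).addSubgroupOf (inv.dualSelmerStructure ρ 𝓕).selmerGroup) *
      Nat.card FS * Nat.card GdS = Nat.card GS * Nat.card GdS := by
    rw [cardG, ← cardL, ← q1, ← q2]; ring
  have cardFS : Nat.card FS = ∏ v ∈ Sf, Nat.card (𝓕 (Sum.inr v)) := by
    rw [natCard_pi_univ, Finset.prod_coe_sort Sf (fun v ↦ Nat.card (𝓕 (Sum.inr v)))]
  have cardGS : Nat.card GS = ∏ v ∈ Sf, Nat.card (𝓖 (Sum.inr v)) := by
    rw [natCard_pi_univ, Finset.prod_coe_sort Sf (fun v ↦ Nat.card (𝓖 (Sum.inr v)))]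
  rw [← cardFS, ← cardGS]
  exact Nat.eq_of_mul_eq_mul_right (Nat.pos_of_ne_zero hGdS0) key

end Count

end Literature.NumberTheory.GaloisCohomology

end
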